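import Summits.CriticalPhenomena.PercolationContinuityZ3.Theorems.FK.InfiniteVolumeDLRDomination
import HarnessLib

/-!
# FK-continuity transplant, FO-10 (infinite-volume structure): exponential decay of connectivities for EVERY DLR
# random-cluster measure (every `q > 0`) below the Bernoulli threshold, transferred from the sharpness of bond percolation

Registered R94 (cell INBOX l.6501, 2026-08-24); registry row FO-10b-g409c; label DLC-B (coordinator fk-4 g196).
Cell `fk-continuity` (bschramm), FO-10b lineage; `--supports stmt-CriticalPhenomena-4575`; builds on p205010 (kernel theorem,
internal audit signed; external expert review pending). CONDITIONAL cell (FH AND TP_FK open at the same `p` for `q > 1`; K1);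
UNCONDITIONAL structure here (`d ≥ 2` for the decay, `0 ≤ p ≤ 1`, every `q > 0`); no defs / sorries; NOT a discharge, NOT `_r4`; n_open = 2.

## What this file proves

By DLL-E (`InfiniteVolumeDLRDomination.lean`: every lattice-carried `P ∈ R_{p,q}` lies below `P_c`,
`c ≥ max(p, p/(p+q(1-p)))`, on increasing local events) and the tree's sharpness of Bernoulli bond percolation
(`Literature…perc_sharpness_holds`, Duminil-Copin–Tassion 2016: `P_c(0 ↔ ∂Λ_n) ≤ e^{-ψ n}` for `c < p_c(ℤ^d)`, `d ≥ 2`):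
* **`IsDLRRandomCluster.measureReal_armEvent_le`** — `P(x ↔ ∂(x + Λ_n)) ≤ P_c(0 ↔ ∂Λ_n)` for every `P ∈ R_{p,q}`, every `x`, `n`;
* **`IsDLRRandomCluster.exists_exp_decay_armEvent`** — if `max(p, p/(p+q(1-p))) < p_c(ℤ^d)` then there is `ψ > 0` with
  `P(x ↔ ∂(x + Λ_n)) ≤ e^{-ψ n}` for all `x`, `n` — EXPONENTIAL DECAY OF THE ONE-ARM PROBABILITY FOR EVERY MEMBER OF `R_{p,q}`
  (for `q < 1`: whenever `p/(p+q(1-p)) < p_c(ℤ^d)`; for `q ≥ 1`: `p < p_c(ℤ^d)`);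
* **`IsDLRRandomCluster.measureReal_openConn_le_exp`** — hence `P(x ↔ y) ≤ e^{-ψ n}` whenever `y - x ∉ Λ_n` (decay of the
  two-point connectivity in `‖y - x‖_∞`).

## References

* G. Grimmett, *The Random-Cluster Model*, Springer 2006: Thm. (3.21) (comparison inequalities), §4.4 Prop. (4.37),
  eq. (3.22) (comparison with product measures). [Grimmett2006]
* H. Duminil-Copin, V. Tassion, *A new proof of the sharpness of the phase transition for Bernoulli percolation on `ℤ^d`*,
  Enseign. Math. 62 (2016), Thm. 1.1. [DuminilCopinTassionEM2016]
-/

noncomputable section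

open MeasureTheory Set Filter
open scoped Topology ENNReal

namespace Summit.CriticalPhenomena.PercolationContinuityZ3.Theorems.FK

open Literature.Probability.Percolation Literature.Probability.LatticeModels
open Literature.Probability.Percolation.DCT16 (armEvent preimage_shift_siteToBoundary
  isUpperSet_siteToBoundary real_armEvent armEvent_of_pathIn)

variable {d : ℕ} {p q : ℝ} {P : Measure (BondConfig (Site d))}

/-- **The one-arm probabilities of a DLR random-cluster measure are dominated by those of `P_c`**,
`c ≥ max(p, p/(p+q(1-p)))`: `P(x ↔ ∂(x + Λ_n)) ≤ P_c(0 ↔ ∂Λ_n)`. [cite: Grimmett2006, Thm. (3.21), Prop. (4.37)(a)] -/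
theorem IsDLRRandomCluster.measureReal_armEvent_le (hP : IsDLRRandomCluster d p q P) (hp : p ∈ Set.Icc (0 : ℝ) 1)
    (hq : 0 < q) (hlat : ∀ᵐ ω ∂P, ω ⊆ (zdGraph d).edgeSet) (c : unitInterval)
    (hpc : max p (p / (p + q * (1 - p))) ≤ (c : ℝ)) (x : Site d) (n : ℕ) :
    P.real (armEvent x n) ≤ (bondPercolation (zdGraph d) c).real (siteToBoundary d n) := by
  classical
  obtain ⟨F, hF⟩ := isLocalEvent_armEvent x n
  have hup : IsUpperSet (armEvent x n) := by
    rw [← preimage_shift_siteToBoundary]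
    exact (isUpperSet_siteToBoundary d n).preimage_relabel _
  have hm : MeasurableSet (armEvent x n) := measurableSet_of_isLocalEvent_holds (isLocalEvent_armEvent x n)
  rw [← real_armEvent c x n]
  exact hP.measureReal_le_bondPercolation_real hp hq hlat c hpc hF hup hm

/-- **Exponential decay of the one-arm probability for EVERY DLR random-cluster measure below the Bernoulli
threshold** (`d ≥ 2`, every `q > 0`): if `max(p, p/(p+q(1-p))) < p_c(ℤ^d)` then `P(x ↔ ∂(x + Λ_n)) ≤ e^{-ψ n}` for some
`ψ > 0` and all `x`, `n` — the sharpness of Bernoulli percolation (Duminil-Copin–Tassion) transferred through the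
comparison inequality. [cite: Grimmett2006, Thm. (3.21); DuminilCopinTassionEM2016, Thm. 1.1(1)] -/
theorem IsDLRRandomCluster.exists_exp_decay_armEvent (hd : 2 ≤ d) (hP : IsDLRRandomCluster d p q P)
    (hp : p ∈ Set.Icc (0 : ℝ) 1) (hq : 0 < q) (hlat : ∀ᵐ ω ∂P, ω ⊆ (zdGraph d).edgeSet)
    (hsub : max p (p / (p + q * (1 - p))) < criticalProb (zdGraph d) 0) :
    ∃ ψ : ℝ, 0 < ψ ∧ ∀ (x : Site d) (n : ℕ), P.real (armEvent x n) ≤ Real.exp (-ψ * n) := by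
  have hc0 : 0 ≤ max p (p / (p + q * (1 - p))) := le_max_of_le_left hp.1
  have hc1 : max p (p / (p + q * (1 - p))) ≤ 1 := by
    refine max_le hp.2 ?_
    rw [div_le_one (add_mul_one_sub_pos hp hq)]
    nlinarith [hq, hp.2]
  set c : unitInterval := ⟨max p (p / (p + q * (1 - p))), hc0, hc1⟩ with hc
  obtain ⟨ψ, hψ, hdec⟩ := DCT16.perc_sharpness_holds hd c (by exact hsub)
  exact ⟨ψ, hψ, fun x n => (hP.measureReal_armEvent_le hp hq hlat c le_rfl x n).trans (hdec n)⟩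

/-- **Exponential decay of the two-point connectivity for every DLR random-cluster measure below the Bernoulli
threshold**: with `ψ` as above, `P(x ↔ y) ≤ e^{-ψ n}` whenever `y - x ∉ Λ_n` (`{x ↔ y} ⊆ {x ↔ ∂(x + Λ_n)}` for lattice
configurations). [cite: Grimmett2006, Thm. (3.21); DuminilCopinTassionEM2016, Thm. 1.1(1)] -/
theorem IsDLRRandomCluster.measureReal_openConn_le_of_armEvent_le (hP : IsDLRRandomCluster d p q P)
    (hlat : ∀ᵐ ω ∂P, ω ⊆ (zdGraph d).edgeSet) {ψ : ℝ}
    (hdec : ∀ (x : Site d) (n : ℕ), P.real (armEvent x n) ≤ Real.exp (-ψ * n)) {x y : Site d} {n : ℕ}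
    (hxy : y - x ∉ box d n) : P.real (openConn x y) ≤ Real.exp (-ψ * n) := by
  haveI := hP.isProbabilityMeasure
  refine le_trans ?_ (hdec x n)
  rw [measureReal_def, measureReal_def]
  refine ENNReal.toReal_mono (measure_ne_top _ _) (measure_mono_ae ?_)
  filter_upwards [hlat] with ω hω hconn
  exact armEvent_of_pathIn hω (DCT16.pathIn_univ_of_reachable hconn) (Or.inl hxy)

end Summit.CriticalPhenomena.PercolationContinuityZ3.Theorems.FK

end
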